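import Literature.MathematicalPhysics.KineticTheory.IllnerShinbrotPicard
import HarnessLib

/-!
# Global mild solutions for a rare gas cloud in the vacuum (Illner–Shinbrot; CIP 1994 Thm 5.2.2)

Topic: MathematicalPhysics / KineticTheory. Fourth layer — and the conclusion — of the existence
half of the named fact `Literature.MathematicalPhysics.KineticTheory.illner_pulvirenti`
(hilbert6.S03: global validity of the Boltzmann equation for a rare gas cloud in all space,
Illner–Pulvirenti 1986/89, Cercignani–Illner–Pulvirenti 1994 Thm 4.5.1). The existence and
bounds asserted there (its first three conjuncts) are CIP 1994 Thm 5.2.2 (p. 137) =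
Illner–Shinbrot, Comm. Math. Phys. 95 (1984):

**Theorem** (`illnerShinbrot_global_mild`). For `β₀ > 0` there is `c₀ = c₀(d, β₀) > 0` such that
every continuous datum `0 ≤ f₀(x, v) ≤ c₀ e^{-(β₀/2)(|x|² + |v|²)}` on `ℝ^d × ℝ^d` launches a global
mild solution `f` of the hard-sphere Boltzmann equation on `ℝ^d`
(`Literature.Analysis.FluidPDE.IsMildBoltzmannSolutionOn T (Euclidean.geometry d) hardSphereKernel f`
for every `T`), with `f(0) = f₀`, jointly continuous, and dispersively bounded:
`0 ≤ f(t, x, v) ≤ 2c₀ e^{-(β₀/2)(|x - tv|² + |v|²)}` for `t ≥ 0` (CIP 1994 (2.5) p. 137).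
Here `c₀ = 1/(16 |S^{d-1}| K_{β₀} + 1)`, `K_β = (2π/β)^{1/2} ∫ e^{-(β/2)|w|²} dw`.

Proof (CIP 1994 §4.5 Step 3 and §5.2; Illner–Shinbrot 1984): Picard iteration of the
sign-corrected Duhamel map of `IllnerShinbrotPicard` in the dispersive ball
`|u(t, y, v)| ≤ 2c₀ e^{-(β₀/2)(|y - t⁺v|² + |v|²)}` — invariant and `1/2`-contracting by
`abs_vacuumPicard_le`, `abs_vacuumPicard_sub_le`, whose constants are finite for ALL times
because of the dispersive line bound `intervalIntegral_dispersiveMajorant_le`; the uniform limit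
is a continuous fixed point (`vacuumPicard_fixedPoint_exists`); it is nonnegative by the
Kaniel–Shinbrot order argument (`vacuumPicard_fixedPoint_nonneg`: at the last time before a
negative value where `u♯ ≥ 0` the integrand `Q̃♯ ≥ 0`), hence `Q̃(u) = Q(u, u)` and `u` is a mild
solution on every `[0, T]` (`vacuumPicard_fixedPoint_isMild`).

No definitions are introduced. The fourth conjunct of `illner_pulvirenti` (convergence of the
BBGKY correlation functions, CIP 1994 Thm 4.5.1 proper) is NOT treated here.

## References

* C. Cercignani, R. Illner, M. Pulvirenti, *The Mathematical Theory of Dilute Gases*, Applied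
  Mathematical Sciences 106, Springer (1994), Thm 5.2.2 p. 137 (and the Kaniel–Shinbrot scheme,
  §5.2 (2.1)–(2.4), pp. 136–137), §4.5 Thm 4.5.1 Step 3, pp. 88–90.
* R. Illner, M. Shinbrot, *The Boltzmann equation: global existence for a rare gas in an
  infinite vacuum*, Comm. Math. Phys. 95 (1984) 217–226.
* S. Kaniel, M. Shinbrot, *The Boltzmann equation. I. Uniqueness and local existence*,
  Comm. Math. Phys. 58 (1978) 65–84.
-/

open MeasureTheory Metric Real Set Filter Topology
open scoped InnerProductSpace ENNReal
open Literature.Analysis.FluidPDE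

namespace Literature.MathematicalPhysics.KineticTheory

noncomputable section

section Existence

variable {d : Type*} [Fintype d]

/-- **The Picard iterates stay in the dispersive ball and contract** (CIP 1994 Thm 5.2.2,
§4.5 Step 3; Illner–Shinbrot 1984). With `K_β = (2π/β)^{1/2} ∫ e^{-(β/2)|w|²} dw`, if
`|f₀(x, v)| ≤ K_f e^{-(β/2)(|x|² + |v|²)}`, `K_f + 4|S| K_β R² ≤ R` and `4|S| K_β R ≤ 1/2`, then
every iterate `uₙ = Φⁿ(0)` of the whole-space Picard map is jointly continuous,
`|uₙ(t, y, v)| ≤ R e^{-(β/2)(|y - t⁺v|² + |v|²)}` and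
`|uₙ₊₁ - uₙ|(t, y, v) ≤ R 2⁻ⁿ e^{-(β/2)(|y - t⁺v|² + |v|²)}`. [cite: CIP1994, Thm 5.2.2] -/
theorem vacuumPicard_iterate_bounds
    {Qa : (EuclideanSpace ℝ d → ℝ) → EuclideanSpace ℝ d → ℝ}
    (hQa : ∀ p v, Qa p v = ∫ w, ∫ ω, hardSphereKernel (v, w) ω *
      (|p (collide ω (v, w)).1| * |p (collide ω (v, w)).2| - p v * |p w|) ∂sphereMeasure)
    {β R Kf : ℝ} (hβ : 0 < β) (hR : 0 ≤ R)
    {f₀ : EuclideanSpace ℝ d → EuclideanSpace ℝ d → ℝ} (hf₀c : Continuous (Function.uncurry f₀))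
    (hf₀b : ∀ x v, |f₀ x v| ≤ Kf * exp (-(β / 2) * (‖x‖ ^ 2 + ‖v‖ ^ 2)))
    (hsmall₁ : Kf + 4 * (sphereMeasure : Measure (sphere (0 : EuclideanSpace ℝ d) 1)).real univ *
        (√(2 * π / β) * ∫ w : EuclideanSpace ℝ d, exp (-(β / 2) * ‖w‖ ^ 2)) * R * R ≤ R)
    (hsmall₂ : 4 * (sphereMeasure : Measure (sphere (0 : EuclideanSpace ℝ d) 1)).real univ *
        (√(2 * π / β) * ∫ w : EuclideanSpace ℝ d, exp (-(β / 2) * ‖w‖ ^ 2)) * R ≤ 1 / 2)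
    {Φ : (ℝ → EuclideanSpace ℝ d → EuclideanSpace ℝ d → ℝ) → ℝ → EuclideanSpace ℝ d →
      EuclideanSpace ℝ d → ℝ}
    (hΦ : ∀ u t y v, Φ u t y v =
      f₀ (y - max 0 t • v) v +
        ∫ τ in (0 : ℝ)..max 0 t, Qa (u τ (y - (max 0 t - τ) • v)) v)
    (n : ℕ) :
    Continuous (fun z : ℝ × EuclideanSpace ℝ d × EuclideanSpace ℝ d =>
        (Φ^[n] 0) z.1 z.2.1 z.2.2) ∧
      (∀ t y v, |(Φ^[n] 0) t y v| ≤
        R * exp (-(β / 2) * (‖y - max 0 t • v‖ ^ 2 + ‖v‖ ^ 2))) ∧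
      (∀ t y v, |(Φ^[n + 1] 0) t y v - (Φ^[n] 0) t y v| ≤
        R * (1 / 2) ^ n * exp (-(β / 2) * (‖y - max 0 t • v‖ ^ 2 + ‖v‖ ^ 2))) := by
  -- the velocity Gaussian bound implied by the dispersive one, for the continuity lemma
  have hweak : ∀ {g : ℝ → EuclideanSpace ℝ d → EuclideanSpace ℝ d → ℝ},
      (∀ t y v, |g t y v| ≤ R * exp (-(β / 2) * (‖y - max 0 t • v‖ ^ 2 + ‖v‖ ^ 2))) →
      ∀ s z x, |g s z x| ≤ R * exp (-(β / 2) * ‖x‖ ^ 2) := fun hg s z x =>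
    (hg s z x).trans (mul_le_mul_of_nonneg_left (exp_dispersive_le_exp_velocity hβ.le _ x) hR)
  -- continuity and the ball, by induction
  have hcb : ∀ n : ℕ,
      Continuous (fun z : ℝ × EuclideanSpace ℝ d × EuclideanSpace ℝ d =>
        (Φ^[n] 0) z.1 z.2.1 z.2.2) ∧
      (∀ t y v, |(Φ^[n] 0) t y v| ≤
        R * exp (-(β / 2) * (‖y - max 0 t • v‖ ^ 2 + ‖v‖ ^ 2))) := by
    intro n
    induction n with
    | zero =>
      refine ⟨?_, fun t y v => ?_⟩
      · have e : (fun z : ℝ × EuclideanSpace ℝ d × EuclideanSpace ℝ d =>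
            (Φ^[0] 0) z.1 z.2.1 z.2.2) = fun _ => 0 := by
          funext z
          simp only [Function.iterate_zero_apply, Pi.zero_apply]
        rw [e]
        exact continuous_const
      · simp only [Function.iterate_zero_apply, Pi.zero_apply, abs_zero]
        exact mul_nonneg hR (exp_pos _).le
    | succ n ih =>
      refine ⟨?_, fun t y v => ?_⟩
      · have e : (fun z : ℝ × EuclideanSpace ℝ d × EuclideanSpace ℝ d =>
            (Φ^[n + 1] 0) z.1 z.2.1 z.2.2) =
            fun z => Φ (Φ^[n] 0) z.1 z.2.1 z.2.2 := by
          funext z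
          rw [Function.iterate_succ_apply']
        rw [e]
        have e2 : (fun z : ℝ × EuclideanSpace ℝ d × EuclideanSpace ℝ d =>
            Φ (Φ^[n] 0) z.1 z.2.1 z.2.2) = fun z =>
            f₀ (z.2.1 - max 0 z.1 • z.2.2) z.2.2 +
              ∫ τ in (0 : ℝ)..max 0 z.1,
                Qa ((Φ^[n] 0) τ (z.2.1 - (max 0 z.1 - τ) • z.2.2)) z.2.2 := by
          funext z
          rw [hΦ]
        rw [e2]
        exact continuous_vacuumPicard hQa ih.1 hβ (hweak ih.2) hf₀c
      · rw [Function.iterate_succ_apply', hΦ]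
        exact abs_vacuumPicard_le hQa hβ hR hf₀b ih.1 ih.2 hsmall₁ t y v
  refine ⟨(hcb n).1, (hcb n).2, ?_⟩
  -- the contraction, by induction
  induction n with
  | zero =>
    intro t y v
    simp only [Function.iterate_zero_apply, Pi.zero_apply, sub_zero,
      pow_zero, mul_one]
    exact (hcb 1).2 t y v
  | succ n ih =>
    intro t y v
    have hD : 0 ≤ R * (1 / 2) ^ n := by positivity
    have h := abs_vacuumPicard_sub_le hQa hβ hR hD f₀ (hcb (n + 1)).1 (hcb n).1 (hcb (n + 1)).2
      (hcb n).2 ih t y v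
    have e1 : (Φ^[n + 1 + 1] 0) t y v = Φ (Φ^[n + 1] 0) t y v := by
      rw [Function.iterate_succ_apply']
    have e2 : (Φ^[n + 1] 0) t y v = Φ (Φ^[n] 0) t y v := by
      rw [Function.iterate_succ_apply']
    rw [e1, e2, hΦ, hΦ]
    refine h.trans ?_
    have hG : 0 ≤ exp (-(β / 2) * (‖y - max 0 t • v‖ ^ 2 + ‖v‖ ^ 2)) := (exp_pos _).le
    calc 4 * (sphereMeasure : Measure (sphere (0 : EuclideanSpace ℝ d) 1)).real univ *
          (√(2 * π / β) * ∫ w : EuclideanSpace ℝ d, exp (-(β / 2) * ‖w‖ ^ 2)) * R *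
          (R * (1 / 2) ^ n) * exp (-(β / 2) * (‖y - max 0 t • v‖ ^ 2 + ‖v‖ ^ 2))
        = (4 * (sphereMeasure : Measure (sphere (0 : EuclideanSpace ℝ d) 1)).real univ *
          (√(2 * π / β) * ∫ w : EuclideanSpace ℝ d, exp (-(β / 2) * ‖w‖ ^ 2)) * R) *
          ((R * (1 / 2) ^ n) * exp (-(β / 2) * (‖y - max 0 t • v‖ ^ 2 + ‖v‖ ^ 2))) := by
          ring
      _ ≤ (1 / 2) * ((R * (1 / 2) ^ n) *
          exp (-(β / 2) * (‖y - max 0 t • v‖ ^ 2 + ‖v‖ ^ 2))) :=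
          mul_le_mul_of_nonneg_right hsmall₂ (mul_nonneg hD hG)
      _ = R * (1 / 2) ^ (n + 1) * exp (-(β / 2) * (‖y - max 0 t • v‖ ^ 2 + ‖v‖ ^ 2)) := by
          ring

/-- **Existence of a continuous fixed point of the whole-space Picard map in the dispersive
ball** (CIP 1994 Thm 5.2.2; Illner–Shinbrot 1984): under the smallness conditions of
`vacuumPicard_iterate_bounds` there is a jointly continuous `u` with
`|u(t, y, v)| ≤ R e^{-(β/2)(|y - t⁺v|² + |v|²)}` for ALL `t` and `Φ(u) = u` (uniform limit of the
iterates; the fixed-point identity by the Lipschitz estimate `abs_vacuumPicard_sub_le`).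
[cite: CIP1994, Thm 5.2.2] -/
theorem vacuumPicard_fixedPoint_exists
    {Qa : (EuclideanSpace ℝ d → ℝ) → EuclideanSpace ℝ d → ℝ}
    (hQa : ∀ p v, Qa p v = ∫ w, ∫ ω, hardSphereKernel (v, w) ω *
      (|p (collide ω (v, w)).1| * |p (collide ω (v, w)).2| - p v * |p w|) ∂sphereMeasure)
    {β R Kf : ℝ} (hβ : 0 < β) (hR : 0 ≤ R)
    {f₀ : EuclideanSpace ℝ d → EuclideanSpace ℝ d → ℝ} (hf₀c : Continuous (Function.uncurry f₀))
    (hf₀b : ∀ x v, |f₀ x v| ≤ Kf * exp (-(β / 2) * (‖x‖ ^ 2 + ‖v‖ ^ 2)))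
    (hsmall₁ : Kf + 4 * (sphereMeasure : Measure (sphere (0 : EuclideanSpace ℝ d) 1)).real univ *
        (√(2 * π / β) * ∫ w : EuclideanSpace ℝ d, exp (-(β / 2) * ‖w‖ ^ 2)) * R * R ≤ R)
    (hsmall₂ : 4 * (sphereMeasure : Measure (sphere (0 : EuclideanSpace ℝ d) 1)).real univ *
        (√(2 * π / β) * ∫ w : EuclideanSpace ℝ d, exp (-(β / 2) * ‖w‖ ^ 2)) * R ≤ 1 / 2)
    {Φ : (ℝ → EuclideanSpace ℝ d → EuclideanSpace ℝ d → ℝ) → ℝ → EuclideanSpace ℝ d →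
      EuclideanSpace ℝ d → ℝ}
    (hΦ : ∀ u t y v, Φ u t y v =
      f₀ (y - max 0 t • v) v +
        ∫ τ in (0 : ℝ)..max 0 t, Qa (u τ (y - (max 0 t - τ) • v)) v) :
    ∃ u : ℝ → EuclideanSpace ℝ d → EuclideanSpace ℝ d → ℝ,
      Continuous (fun z : ℝ × EuclideanSpace ℝ d × EuclideanSpace ℝ d => u z.1 z.2.1 z.2.2) ∧
      (∀ t y v, |u t y v| ≤ R * exp (-(β / 2) * (‖y - max 0 t • v‖ ^ 2 + ‖v‖ ^ 2))) ∧
      ∀ t y v, Φ u t y v = u t y v := by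
  have hL := vacuumPicard_iterate_bounds hQa hβ hR hf₀c hf₀b hsmall₁ hsmall₂ hΦ
  set G : ℝ → EuclideanSpace ℝ d → EuclideanSpace ℝ d → ℝ := fun t y v =>
    exp (-(β / 2) * (‖y - max 0 t • v‖ ^ 2 + ‖v‖ ^ 2)) with hG_def
  have hG0 : ∀ t y v, 0 < G t y v := fun t y v => exp_pos _
  have hG1 : ∀ t y v, G t y v ≤ 1 := fun t y v => by
    simp only [hG_def]
    rw [exp_le_one_iff]
    nlinarith [sq_nonneg ‖y - max 0 t • v‖, sq_nonneg ‖v‖, hβ.le]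
  -- geometric control of the iterates at each point
  have hdist : ∀ t y v (n : ℕ), dist ((Φ^[n] 0) t y v) ((Φ^[n + 1] 0) t y v) ≤
      (R * G t y v) * (1 / 2) ^ n := fun t y v n => by
    rw [dist_comm, Real.dist_eq]
    calc |(Φ^[n + 1] 0) t y v - (Φ^[n] 0) t y v| ≤ R * (1 / 2) ^ n * G t y v := (hL n).2.2 t y v
      _ = (R * G t y v) * (1 / 2) ^ n := by ring
  have hcauchy : ∀ t y v, CauchySeq fun n : ℕ => (Φ^[n] 0) t y v := fun t y v =>
    cauchySeq_of_le_geometric (1 / 2) (R * G t y v) (by norm_num) (hdist t y v)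
  set u : ℝ → EuclideanSpace ℝ d → EuclideanSpace ℝ d → ℝ := fun t y v =>
    limUnder atTop fun n : ℕ => (Φ^[n] 0) t y v with hu_def
  have hlim : ∀ t y v, Tendsto (fun n : ℕ => (Φ^[n] 0) t y v) atTop (𝓝 (u t y v)) := fun t y v =>
    tendsto_nhds_limUnder (cauchySeq_tendsto_of_complete (hcauchy t y v))
  have herr : ∀ (n : ℕ) t y v, |(Φ^[n] 0) t y v - u t y v| ≤ 2 * R * (1 / 2) ^ n * G t y v := by
    intro n t y v
    have h := dist_le_of_le_geometric_of_tendsto (1 / 2) (R * G t y v) (by norm_num) (hdist t y v)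
      (hlim t y v) n
    rw [Real.dist_eq] at h
    refine h.trans (le_of_eq ?_)
    ring
  -- continuity of the limit: the convergence is uniform
  have hu_cont : Continuous (fun z : ℝ × EuclideanSpace ℝ d × EuclideanSpace ℝ d =>
      u z.1 z.2.1 z.2.2) := by
    have hunif : TendstoUniformly
        (fun (n : ℕ) (z : ℝ × EuclideanSpace ℝ d × EuclideanSpace ℝ d) => (Φ^[n] 0) z.1 z.2.1 z.2.2)
        (fun z => u z.1 z.2.1 z.2.2) atTop := by
      refine Metric.tendstoUniformly_iff.2 fun ε hε => ?_
      obtain ⟨N, hN⟩ := exists_pow_lt_of_lt_one (div_pos hε (by positivity : (0 : ℝ) < 2 * R + 1))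
        (by norm_num : (1 / 2 : ℝ) < 1)
      refine eventually_atTop.2 ⟨N, fun n hn z => ?_⟩
      rw [dist_comm, Real.dist_eq]
      have hpow : ((1 : ℝ) / 2) ^ n ≤ (1 / 2) ^ N :=
        pow_le_pow_of_le_one (by norm_num) (by norm_num) hn
      have hpos : 0 ≤ ((1 : ℝ) / 2) ^ n := by positivity
      calc |(Φ^[n] 0) z.1 z.2.1 z.2.2 - u z.1 z.2.1 z.2.2| ≤ 2 * R * (1 / 2) ^ n * G z.1 z.2.1 z.2.2 :=
            herr n _ _ _
        _ ≤ 2 * R * (1 / 2) ^ n * 1 := by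
            have := hG1 z.1 z.2.1 z.2.2
            have : 0 ≤ 2 * R * (1 / 2) ^ n := by positivity
            gcongr
        _ ≤ (2 * R + 1) * (1 / 2) ^ N := by
            nlinarith [mul_le_mul_of_nonneg_left hpow (by positivity : (0 : ℝ) ≤ 2 * R),
              pow_nonneg (by norm_num : (0 : ℝ) ≤ 1 / 2) N]
        _ < (2 * R + 1) * (ε / (2 * R + 1)) := by gcongr
        _ = ε := by field_simp
    exact hunif.continuous (Eventually.of_forall fun n => (hL n).1).frequently
  -- the ball
  have hu_bound : ∀ t y v, |u t y v| ≤ R * G t y v := fun t y v =>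
    le_of_tendsto' ((continuous_abs.tendsto _).comp (hlim t y v)) fun n => (hL n).2.1 t y v
  refine ⟨u, hu_cont, hu_bound, fun t y v => ?_⟩
  -- the fixed-point identity
  have h1 : Tendsto (fun n => (Φ^[n + 1] 0) t y v) atTop (𝓝 (u t y v)) :=
    (hlim t y v).comp (tendsto_add_atTop_nat 1)
  have h2 : Tendsto (fun n => (Φ^[n + 1] 0) t y v) atTop (𝓝 (Φ u t y v)) := by
    refine Metric.tendsto_atTop.2 fun ε hε => ?_
    obtain ⟨N, hN⟩ := exists_pow_lt_of_lt_one (div_pos hε (by positivity : (0 : ℝ) < R + 1))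
      (by norm_num : (1 / 2 : ℝ) < 1)
    refine ⟨N, fun n hn => ?_⟩
    have hD : 0 ≤ 2 * R * (1 / 2) ^ n := by positivity
    have hb := abs_vacuumPicard_sub_le hQa hβ hR hD f₀ (hL n).1 hu_cont (hL n).2.1
      hu_bound (herr n) t y v
    have hstep : (Φ^[n + 1] 0) t y v = Φ (Φ^[n] 0) t y v := by
      rw [Function.iterate_succ_apply']
    rw [Real.dist_eq, hstep, hΦ, hΦ]
    refine lt_of_le_of_lt hb ?_
    have hpow : ((1 : ℝ) / 2) ^ n ≤ (1 / 2) ^ N :=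
      pow_le_pow_of_le_one (by norm_num) (by norm_num) hn
    calc 4 * (sphereMeasure : Measure (sphere (0 : EuclideanSpace ℝ d) 1)).real univ *
          (√(2 * π / β) * ∫ w : EuclideanSpace ℝ d, exp (-(β / 2) * ‖w‖ ^ 2)) * R *
          (2 * R * (1 / 2) ^ n) * G t y v
        ≤ (1 / 2) * (2 * R * (1 / 2) ^ n) * 1 := by
          have hG1' : exp (-(β / 2) * (‖y - max 0 t • v‖ ^ 2 + ‖v‖ ^ 2)) ≤ 1 := hG1 t y v
          have hG0' : 0 ≤ exp (-(β / 2) * (‖y - max 0 t • v‖ ^ 2 + ‖v‖ ^ 2)) := (hG0 t y v).le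
          gcongr
      _ ≤ (R + 1) * (1 / 2) ^ N := by
          nlinarith [mul_le_mul_of_nonneg_left hpow hR, pow_nonneg (by norm_num : (0 : ℝ) ≤ 1 / 2) N]
      _ < (R + 1) * (ε / (R + 1)) := by gcongr
      _ = ε := by field_simp
  exact tendsto_nhds_unique h2 h1

/-- **Positivity of the fixed point** (the order argument of the Kaniel–Shinbrot scheme,
CIP 1994 §5.2 (2.1)–(2.4), Kaniel–Shinbrot 1978 §2). Let `u` be jointly continuous on
`ℝ × ℝ^d × ℝ^d` with a Gaussian velocity bound and satisfy the sign-corrected Duhamel identity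
along the free characteristics of `ℝ^d`,
`u(t, x + tv, v) = f₀(x, v) + ∫₀ᵗ Q̃(u(τ, x + τv, ·))(v) dτ` for `t ≥ 0`, with `f₀ ≥ 0`. Then
`u(t) ≥ 0` for every `t ≥ 0`: at the last time `s₀ ≤ t₁` where `u♯ ≥ 0` one has `u♯(s₀) = 0`,
and on `(s₀, t₁]` the integrand `Q̃♯ ≥ 0` (`absCollision_nonneg_of_nonpos`), so
`u♯(t₁) ≥ u♯(s₀) = 0`. [cite: CIP1994, §5.2 (2.1)–(2.4)] -/
theorem vacuumPicard_fixedPoint_nonneg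
    {Qa : (EuclideanSpace ℝ d → ℝ) → EuclideanSpace ℝ d → ℝ}
    (hQa : ∀ p v, Qa p v = ∫ w, ∫ ω, hardSphereKernel (v, w) ω *
      (|p (collide ω (v, w)).1| * |p (collide ω (v, w)).2| - p v * |p w|) ∂sphereMeasure)
    {R γ : ℝ} (hγ : 0 < γ) {f₀ : EuclideanSpace ℝ d → EuclideanSpace ℝ d → ℝ}
    (hf₀nn : ∀ x v, 0 ≤ f₀ x v) {u : ℝ → EuclideanSpace ℝ d → EuclideanSpace ℝ d → ℝ}
    (hu : Continuous fun z : ℝ × EuclideanSpace ℝ d × EuclideanSpace ℝ d => u z.1 z.2.1 z.2.2)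
    (hub : ∀ t y v, |u t y v| ≤ R * exp (-(γ / 2) * ‖v‖ ^ 2))
    (hchar : ∀ x v t, 0 ≤ t → u t (x + t • v) v =
      f₀ x v + ∫ τ in (0 : ℝ)..t, Qa (u τ (x + τ • v)) v) :
    ∀ t, 0 ≤ t → ∀ y v, 0 ≤ u t y v := by
  have hF := continuous_absCollision_slice' hQa hu hγ hub
  -- reduce to characteristics
  suffices hsuff : ∀ x v t, 0 ≤ t → 0 ≤ u t (x + t • v) v by
    intro t ht y v
    have h := hsuff (y - t • v) v t ht
    rwa [sub_add_cancel] at h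
  intro x v
  set Y : ℝ → ℝ := fun t => u t (x + t • v) v with hY_def
  set A : ℝ → ℝ := fun t => Qa (u t (x + t • v)) v with hA_def
  have hcurve : Continuous fun t : ℝ =>
      ((t, x + t • v, v) : ℝ × EuclideanSpace ℝ d × EuclideanSpace ℝ d) := by fun_prop
  have hYc : Continuous Y := hu.comp hcurve
  have hAc : Continuous A := hF.comp hcurve
  have hYeq : ∀ t, 0 ≤ t → Y t = f₀ x v + ∫ τ in (0 : ℝ)..t, A τ := hchar x v
  have hApos : ∀ t, Y t ≤ 0 → 0 ≤ A t := fun t hYt =>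
    absCollision_nonneg_of_nonpos hQa (p := u t (x + t • v)) (v := v) hYt
  -- the claim along the characteristic, by contradiction
  intro t₁ ht₁
  have hY0 : Y 0 = f₀ x v := by
    have h := hYeq 0 le_rfl
    simpa using h
  show 0 ≤ Y t₁
  by_contra hneg
  push Not at hneg
  set Z : Set ℝ := Icc 0 t₁ ∩ {s | 0 ≤ Y s} with hZ_def
  have hZ0 : (0 : ℝ) ∈ Z := ⟨⟨le_rfl, ht₁⟩, by
    show 0 ≤ Y 0
    rw [hY0]; exact hf₀nn x v⟩
  have hZbdd : BddAbove Z := ⟨t₁, fun s hs => hs.1.2⟩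
  have hZclosed : IsClosed Z := isClosed_Icc.inter (isClosed_le continuous_const hYc)
  set s₀ : ℝ := sSup Z with hs₀_def
  have hs₀Z : s₀ ∈ Z := hZclosed.csSup_mem ⟨0, hZ0⟩ hZbdd
  have hs₀_ge : ∀ s ∈ Z, s ≤ s₀ := fun s hs => le_csSup hZbdd hs
  have hs₀t₁ : s₀ ≤ t₁ := hs₀Z.1.2
  have hYs₀_nonneg : 0 ≤ Y s₀ := hs₀Z.2
  have hs₀lt : s₀ < t₁ := lt_of_le_of_ne hs₀t₁ fun h => by
    rw [h] at hYs₀_nonneg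
    exact absurd hYs₀_nonneg (not_le.2 hneg)
  have hYneg : ∀ s, s₀ < s → s ≤ t₁ → Y s < 0 := fun s hs hst₁ => by
    by_contra h
    push Not at h
    exact absurd (hs₀_ge s ⟨⟨hs₀Z.1.1.trans hs.le, hst₁⟩, h⟩) (not_le.2 hs)
  -- `Y s₀ = 0` by continuity and maximality
  have hYs₀ : Y s₀ = 0 := by
    refine le_antisymm ?_ hYs₀_nonneg
    by_contra hpos
    push Not at hpos
    obtain ⟨δ, hδ, hδY⟩ := Metric.continuousAt_iff.1 hYc.continuousAt (Y s₀) hpos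
    set s : ℝ := min (s₀ + δ / 2) t₁ with hs_def
    have hs1 : s₀ < s := lt_min (by linarith) hs₀lt
    have hs2 : s ≤ t₁ := min_le_right _ _
    have hs3 : dist s s₀ < δ := by
      rw [Real.dist_eq, abs_of_pos (sub_pos.2 hs1)]
      linarith [min_le_left (s₀ + δ / 2) t₁]
    have h := hδY hs3
    rw [Real.dist_eq, abs_lt] at h
    have hYs : 0 < Y s := by linarith [h.1]
    exact absurd (hYneg s hs1 hs2) (not_lt.2 hYs.le)
  -- integrate the sign information on `[s₀, t₁]`
  have hdiff : Y t₁ - Y s₀ = ∫ τ in s₀..t₁, A τ := by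
    rw [hYeq t₁ ht₁, hYeq s₀ hs₀Z.1.1, add_sub_add_left_eq_sub,
      intervalIntegral.integral_interval_sub_left (hAc.intervalIntegrable _ _)
        (hAc.intervalIntegrable _ _)]
  have hint : 0 ≤ ∫ τ in s₀..t₁, A τ :=
    intervalIntegral.integral_nonneg hs₀t₁ fun τ hτ => by
      rcases hτ.1.eq_or_lt with h | h
      · rw [← h]
        exact hApos s₀ hYs₀.le
      · exact hApos τ (hYneg τ h hτ.2).le
  linarith

/-- **A nonnegative fixed point of the sign-corrected Duhamel map is a global mild solution.**
Let `u` be jointly continuous with a Gaussian velocity bound and satisfy `Φ(u) = u` for the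
whole-space Picard map of `IllnerShinbrotPicard` with datum `f₀ ≥ 0`. Then `u(t) ≥ 0` for
`t ≥ 0` (`vacuumPicard_fixedPoint_nonneg`), hence `Q̃(u(τ, y, ·)) = Q(u, u)(τ, y, ·)` there
(`absCollision_eq_collisionOpWith`), and Duhamel's formula along the free flow of `ℝ^d` holds on
every `[0, T]`: `u` is a mild solution of the hard-sphere Boltzmann equation on `ℝ^d` for every
horizon `T`, with `u(0) = f₀` (CIP 1994 Thm 5.2.2; GST 2013 §2.1, Def. of mild solutions).
[cite: CIP1994, Thm 5.2.2] -/
theorem vacuumPicard_fixedPoint_isMild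
    {Qa : (EuclideanSpace ℝ d → ℝ) → EuclideanSpace ℝ d → ℝ}
    (hQa : ∀ p v, Qa p v = ∫ w, ∫ ω, hardSphereKernel (v, w) ω *
      (|p (collide ω (v, w)).1| * |p (collide ω (v, w)).2| - p v * |p w|) ∂sphereMeasure)
    {R γ : ℝ} (hγ : 0 < γ) {f₀ : EuclideanSpace ℝ d → EuclideanSpace ℝ d → ℝ}
    (hf₀nn : ∀ x v, 0 ≤ f₀ x v) {u : ℝ → EuclideanSpace ℝ d → EuclideanSpace ℝ d → ℝ}
    (hu : Continuous fun z : ℝ × EuclideanSpace ℝ d × EuclideanSpace ℝ d => u z.1 z.2.1 z.2.2)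
    (hub : ∀ t y v, |u t y v| ≤ R * exp (-(γ / 2) * ‖v‖ ^ 2))
    (hfix : ∀ t y v,
      f₀ (y - max 0 t • v) v +
        ∫ τ in (0 : ℝ)..max 0 t, Qa (u τ (y - (max 0 t - τ) • v)) v = u t y v) (T : ℝ) :
    IsMildBoltzmannSolutionOn T (Euclidean.geometry d) hardSphereKernel u ∧ u 0 = f₀ := by
  have hF := continuous_absCollision_slice' hQa hu hγ hub
  -- the Duhamel identity along characteristics, with the sign-corrected operator
  have hchar : ∀ x v t, 0 ≤ t →
      u t (x + t • v) v = f₀ x v + ∫ τ in (0 : ℝ)..t, Qa (u τ (x + τ • v)) v := by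
    intro x v t ht
    have h := hfix t (x + t • v) v
    rw [max_eq_right ht, add_sub_cancel_right] at h
    have e2 : ∀ τ : ℝ, x + t • v - (t - τ) • v = x + τ • v := fun τ => by
      rw [sub_smul]
      abel
    simp_rw [e2] at h
    exact h.symm
  have hcurve : ∀ (x v : EuclideanSpace ℝ d), Continuous fun τ : ℝ =>
      ((τ, x + τ • v, v) : ℝ × EuclideanSpace ℝ d × EuclideanSpace ℝ d) := fun x v => by fun_prop
  -- the initial value
  have hu0 : ∀ x v, u 0 x v = f₀ x v := fun x v => by
    have h := hchar x v 0 le_rfl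
    simpa using h
  -- positivity
  have hnonneg : ∀ t, 0 ≤ t → ∀ y v, 0 ≤ u t y v :=
    vacuumPicard_fixedPoint_nonneg hQa hγ hf₀nn hu hub hchar
  -- identification of the collision terms for `τ ≥ 0`
  have hQ : ∀ x v τ, 0 ≤ τ →
      alongFlow (Euclidean.geometry d) (collisionTerm hardSphereKernel u) τ x v =
        Qa (u τ (x + τ • v)) v := by
    intro x v τ hτ
    simp only [alongFlow, collisionTerm, Euclidean.geometry_translate]
    exact (absCollision_eq_collisionOpWith hQa (fun w => hnonneg τ hτ _ w) v).symm
  refine ⟨⟨fun t ht => hnonneg t ht.1, fun x v t ht => ?_, fun x v t ht => ?_⟩,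
    funext fun y => funext fun v => hu0 y v⟩
  · -- interval integrability of the collision term along characteristics
    have hA : IntervalIntegrable (fun τ => Qa (u τ (x + τ • v)) v) volume 0 t :=
      ((hF.comp (hcurve x v)).intervalIntegrable _ _)
    refine hA.congr ?_
    intro τ hτ
    rw [uIoc_of_le ht.1] at hτ
    exact (hQ x v τ hτ.1.le).symm
  · -- Duhamel's formula
    have lhs : alongFlow (Euclidean.geometry d) u t x v = u t (x + t • v) v := by
      simp only [alongFlow, Euclidean.geometry_translate]
    rw [lhs, hchar x v t ht.1, hu0 x v]
    congr 1
    refine intervalIntegral.integral_congr fun τ hτ => ?_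
    rw [uIcc_of_le ht.1] at hτ
    exact (hQ x v τ hτ.1).symm

/-- **Global mild solutions for a rare gas cloud expanding in the vacuum** (Illner–Shinbrot,
Comm. Math. Phys. 95 (1984); Cercignani–Illner–Pulvirenti 1994 Thm 5.2.2 p. 137, "part of
Theorem 4.5.1"; the existence half — conjuncts 1–3 — of the named fact `illner_pulvirenti`,
hilbert6.S03). For every `β₀ > 0` there is `c₀ = c₀(d, β₀) > 0` (here
`c₀ = 1/(16 |S^{d-1}| K_{β₀} + 1)`, `K_β = (2π/β)^{1/2} ∫ e^{-(β/2)|w|²} dw`) such that for every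
continuous `f₀` with `0 ≤ f₀(x, v) ≤ c₀ e^{-(β₀/2)(|x|² + |v|²)}` the hard-sphere Boltzmann
equation on `ℝ^d` has a global mild solution `f` (a mild solution on `[0, T]` for every `T`)
with `f(0) = f₀`, dispersively bounded — `0 ≤ f(t, x, v) ≤ 2c₀ e^{-(β₀/2)(|x - tv|² + |v|²)}`
for `t ≥ 0` (CIP 1994 (2.5)) —, jointly continuous, and with
`|f(t, x, v)| ≤ 2c₀ e^{-(β₀/2)(|x - t⁺v|² + |v|²)}` for all real `t`. The printed theorem is
stated for `d = 3` and a.e. data in `L¹_+`; the continuous pointwise-mild version proved here is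
what `illner_pulvirenti` asks for. [cite: CIP1994, Thm 5.2.2] -/
theorem illnerShinbrot_global_mild {β₀ : ℝ} (hβ₀ : 0 < β₀) :
    ∃ c₀ > (0 : ℝ), ∀ f₀ : EuclideanSpace ℝ d → EuclideanSpace ℝ d → ℝ,
      Continuous (Function.uncurry f₀) →
      (∀ x v, 0 ≤ f₀ x v ∧ f₀ x v ≤ c₀ * exp (-(β₀ / 2) * (‖x‖ ^ 2 + ‖v‖ ^ 2))) →
      ∃ f : ℝ → EuclideanSpace ℝ d → EuclideanSpace ℝ d → ℝ,
        (∀ T > (0 : ℝ),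
          IsMildBoltzmannSolutionOn T (Euclidean.geometry d) hardSphereKernel f) ∧
        f 0 = f₀ ∧
        (∃ C β : ℝ, 0 < β ∧ ∀ t ≥ (0 : ℝ), ∀ x v,
          0 ≤ f t x v ∧ f t x v ≤ C * exp (-(β / 2) * (‖x - t • v‖ ^ 2 + ‖v‖ ^ 2))) ∧
        Continuous (fun z : ℝ × EuclideanSpace ℝ d × EuclideanSpace ℝ d => f z.1 z.2.1 z.2.2) ∧
        (∀ t x v, |f t x v| ≤ 2 * c₀ * exp (-(β₀ / 2) * (‖x - max 0 t • v‖ ^ 2 + ‖v‖ ^ 2))) := by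
  -- constants
  set S : ℝ := (sphereMeasure : Measure (sphere (0 : EuclideanSpace ℝ d) 1)).real univ with hS
  set Kβ : ℝ := √(2 * π / β₀) * ∫ w : EuclideanSpace ℝ d, exp (-(β₀ / 2) * ‖w‖ ^ 2) with hKβ
  have hS0 : 0 ≤ S := measureReal_nonneg
  have hKβ0 : 0 ≤ Kβ := mul_nonneg (Real.sqrt_nonneg _) (integral_nonneg fun w => (exp_pos _).le)
  set A : ℝ := 16 * S * Kβ with hA_def
  have hA0 : 0 ≤ A := by positivity
  set c₀ : ℝ := 1 / (A + 1) with hc₀_def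
  have hc₀ : 0 < c₀ := by positivity
  have hAc : A * c₀ ≤ 1 := by
    rw [hc₀_def, mul_one_div, div_le_one (by positivity)]
    linarith
  refine ⟨c₀, hc₀, fun f₀ hf₀c hf₀b => ?_⟩
  -- the smallness conditions with `R = 2 c₀`
  have hR : (0 : ℝ) ≤ 2 * c₀ := by positivity
  have hsmall₂ : 4 * S * Kβ * (2 * c₀) ≤ 1 / 2 := by
    have : 4 * S * Kβ * (2 * c₀) = A * c₀ / 2 := by simp only [hA_def]; ring
    rw [this]
    linarith
  have hsmall₁ : c₀ + 4 * S * Kβ * (2 * c₀) * (2 * c₀) ≤ 2 * c₀ := by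
    have : 4 * S * Kβ * (2 * c₀) * (2 * c₀) = c₀ * (A * c₀) := by simp only [hA_def]; ring
    rw [this]
    nlinarith [mul_le_mul_of_nonneg_left hAc hc₀.le]
  have hf₀nn : ∀ x v, 0 ≤ f₀ x v := fun x v => (hf₀b x v).1
  have hf₀b' : ∀ x v, |f₀ x v| ≤ c₀ * exp (-(β₀ / 2) * (‖x‖ ^ 2 + ‖v‖ ^ 2)) := fun x v => by
    rw [abs_of_nonneg (hf₀nn x v)]
    exact (hf₀b x v).2
  -- the sign-corrected collision operator and the Picard map
  set Qa : (EuclideanSpace ℝ d → ℝ) → EuclideanSpace ℝ d → ℝ := fun p v =>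
    ∫ w, ∫ ω, hardSphereKernel (v, w) ω *
      (|p (collide ω (v, w)).1| * |p (collide ω (v, w)).2| - p v * |p w|) ∂sphereMeasure
    with hQa_def
  have hQa : ∀ p v, Qa p v = ∫ w, ∫ ω, hardSphereKernel (v, w) ω *
      (|p (collide ω (v, w)).1| * |p (collide ω (v, w)).2| - p v * |p w|) ∂sphereMeasure :=
    fun p v => rfl
  set Φ : (ℝ → EuclideanSpace ℝ d → EuclideanSpace ℝ d → ℝ) → ℝ → EuclideanSpace ℝ d →
      EuclideanSpace ℝ d → ℝ := fun u t y v =>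
    f₀ (y - max 0 t • v) v +
      ∫ τ in (0 : ℝ)..max 0 t, Qa (u τ (y - (max 0 t - τ) • v)) v with hΦ_def
  have hΦ : ∀ u t y v, Φ u t y v =
      f₀ (y - max 0 t • v) v +
        ∫ τ in (0 : ℝ)..max 0 t, Qa (u τ (y - (max 0 t - τ) • v)) v := fun _ _ _ _ => rfl
  obtain ⟨u, hu, hub, hfix⟩ := vacuumPicard_fixedPoint_exists hQa hβ₀ hR hf₀c hf₀b' hsmall₁
    hsmall₂ hΦ
  -- the velocity Gaussian bound
  have hub' : ∀ t y v, |u t y v| ≤ 2 * c₀ * exp (-(β₀ / 2) * ‖v‖ ^ 2) := fun t y v =>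
    (hub t y v).trans (mul_le_mul_of_nonneg_left (exp_dispersive_le_exp_velocity hβ₀.le _ v) hR)
  have hmild := fun T : ℝ => vacuumPicard_fixedPoint_isMild hQa hβ₀ hf₀nn hu hub'
    (fun t y v => (hΦ u t y v).symm.trans (hfix t y v)) T
  refine ⟨u, fun T _ => (hmild T).1, (hmild 0).2, ⟨2 * c₀, β₀, hβ₀, fun t ht x v => ⟨?_, ?_⟩⟩,
    hu, hub⟩
  · exact (hmild t).1.nonneg t ⟨ht, le_rfl⟩ x v
  · have h := (le_abs_self _).trans (hub t x v)
    rwa [max_eq_right ht] at h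

end Existence

end

end Literature.MathematicalPhysics.KineticTheory
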